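import Summits.Ventures.PercRepro.SixFourResidueThreePlaneLineX2
import Summits.Ventures.PercRepro.SixFourResidueThreePlaneLineTable
import Summits.Ventures.PercRepro.SixFourResidueThreePlaneLineMargin

/-!
# PercRepro — C-025 at `(6,4)`: the plane-line branch (γ) of the `t = 3` tail, part 4 — `0 ≤ J₃(G)` for every plane-line solid with `g ≥ 11` (p2, gen 10)

The assembly: for a rank-`4` set `G ⊆ E` of a simple matroid with `g ≥ 11` points all of whose plane traces have
`≤ g − 3` points, every rank-`3` trace has `slack(P) ≥ 12/5` (`slack_ge_twelve_fifths`: `slack_ge_of_mu` with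
`μ = (base₃ + 12/5)/C(p,2)` and the margin form of the per-pair inequality — the table `perPairM3_of_range` for
`11 ≤ g ≤ 100`, mine-2's `perPair3_margin_twelve_fifths` for `g ≥ 101`), so `J₃ ≥ Σ_{r = 3} slack(P) − (6/5)·X₂ ≥ (12/5)·#ccPlanes − (6/5)·2·#ccPlanes = 0`
(`J_three_ge_sum_slack_sub`, `X2cnt_le_two_mul_card_ccPlanes`): **`J_three_nonneg_of_planeLine`** — no genericity
hypothesis is needed, and no plane cap beyond the branch's own `≤ g − 3`.
-/

namespace PercRepro.SixFour

/-- **The margin form of the per-pair inequality for every `g ≥ 11`**, `3 ≤ p ≤ g − 3`, `2 ≤ m < p`. -/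
theorem perPairM3_all {g p m : ℕ} (hg : 11 ≤ g) (hp : 3 ≤ p) (hpg : p + 3 ≤ g) (hm : 2 ≤ m) (hmp : m < p) :
    (m.choose 2 : ℚ) * (base3 g p + 12 / 5) ≤ (p.choose 2 : ℚ) * Lterm3 g p m := by
  rcases Nat.lt_or_ge 100 g with h | h
  · exact perPair3_margin_twelve_fifths (by omega) hp hpg hm hmp
  · exact perPairM3_of_range hg h hp hpg hm hmp

open Finset ThmH

variable {α : Type*} [DecidableEq α] {M : Matroid α} [M.Finite] {G : Finset α}

omit [DecidableEq α] in
/-- A set of rank `3` has at least `3` points. -/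
theorem three_le_card_of_eRk_eq_three' {B : Finset α} (hr : M.eRk (B : Set α) = 3) : 3 ≤ B.card := by
  obtain ⟨k, hk, hkc⟩ := eRk_eq_nat M B
  rw [hk] at hr
  have : k = 3 := by exact_mod_cast hr
  omega

/-- **`slack(P) ≥ 12/5`** on every rank-`3` trace with `≤ g − 3` points of a rank-`4` set with `g ≥ 11`. -/
theorem slack_ge_twelve_fifths (hs : Simple M) (hG : G ⊆ gr M) {P : Finset α}
    (hr3 : M.eRk ((P ∩ G : Finset α) : Set α) = 3) (hg : 11 ≤ G.card) (hpl : (P ∩ G).card + 3 ≤ G.card) :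
    12 / 5 ≤ slack3 M G P := by
  have hp3 : 3 ≤ (P ∩ G).card := three_le_card_of_eRk_eq_three' hr3
  have hC : (0 : ℚ) < ((P ∩ G).card.choose 2 : ℚ) := by
    have : 0 < (P ∩ G).card.choose 2 := Nat.choose_pos (by omega)
    exact_mod_cast this
  have hpp : ∀ m, 2 ≤ m → m < (P ∩ G).card →
      (base3 G.card (P ∩ G).card + 12 / 5) / ((P ∩ G).card.choose 2 : ℚ) * (m.choose 2 : ℚ) ≤
        Lterm3 G.card (P ∩ G).card m := by
    intro m hm hmp
    have h := perPairM3_all hg hp3 hpl hm hmp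
    rw [div_mul_eq_mul_div, div_le_iff₀ hC]
    linarith
  have h := slack_ge_of_mu hs hG hr3 _ hpp
  have hC' : ((P ∩ G).card.choose 2 : ℚ) ≠ 0 := hC.ne'
  have e : ((P ∩ G).card.choose 2 : ℚ) * ((base3 G.card (P ∩ G).card + 12 / 5) / ((P ∩ G).card.choose 2 : ℚ)) =
      base3 G.card (P ∩ G).card + 12 / 5 := by
    field_simp
  rw [e] at h
  linarith

/-- **The plane-line branch of Theorem 21′**: `0 ≤ J₃(G)` for every rank-`4` set `G ⊆ E` of a simple matroid with
`g ≥ 11` points all of whose plane traces have at most `g − 3` points. -/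
theorem J_three_nonneg_of_planeLine (hs : Simple M) (hG : G ⊆ gr M) (hr : M.eRk (G : Set α) = 4)
    (hpl : ∀ P ∈ planes M, (P ∩ G).card + 3 ≤ G.card) (hg : 11 ≤ G.card) : 0 ≤ J M G 3 := by
  have hX := X2cnt_le_two_mul_card_ccPlanes hs hG hr (fun P hP => by have := hpl P hP; omega)
  have hJ := J_three_ge_sum_slack_sub hs hG hr (by omega)
  set S := (planes M).filter (fun P : Finset α => M.eRk ((P ∩ G : Finset α) : Set α) = 3) with hS
  have hccS : ccPlanes M G ⊆ S := by
    intro P hP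
    rw [mem_ccPlanes] at hP
    rw [hS, Finset.mem_filter]
    exact ⟨hP.1, hP.2.1⟩
  have hnn : ∀ P ∈ S, P ∉ ccPlanes M G → 0 ≤ slack3 M G P := by
    intro P hP _
    rw [hS, Finset.mem_filter] at hP
    have := slack_ge_twelve_fifths hs hG hP.2 hg (hpl P hP.1)
    linarith
  have hsum1 : ∑ P ∈ ccPlanes M G, slack3 M G P ≤ ∑ P ∈ S, slack3 M G P :=
    Finset.sum_le_sum_of_subset_of_nonneg hccS hnn
  have hsum2 : ∑ _P ∈ ccPlanes M G, (12 / 5 : ℚ) ≤ ∑ P ∈ ccPlanes M G, slack3 M G P := by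
    apply Finset.sum_le_sum
    intro P hP
    rw [mem_ccPlanes] at hP
    exact slack_ge_twelve_fifths hs hG hP.2.1 hg (hpl P hP.1)
  rw [Finset.sum_const, nsmul_eq_mul] at hsum2
  have hX' : (X2cnt M G : ℚ) ≤ 2 * ((ccPlanes M G).card : ℚ) := by exact_mod_cast hX
  linarith

end PercRepro.SixFour
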